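import Summits.BirchSwinnertonDyer.BirchSwinnertonDyer.Theorems.BiquadraticEisensteinDescentHeegnerTwistCouplingInSupplySylvesterTwistPhiBox
import HarnessLib

set_option linter.dupNamespace false -- `Summit.BirchSwinnertonDyer.BirchSwinnertonDyer.Theorems.…` (summit = sub, D-0017)
set_option autoImplicit false

/-!
# Crux `HeegnerTwistCouplingInSupply` (stmt-BirchSwinnertonDyer-21381) — programme «TWISTED 3-ISOGENY DESCENT», file P7c-B1:
# the `φ`-box of P5c in SELMER form: a locally trivial norm-cube parameter `u ∈ ℚ(√6)^×` IS A CUBE (certificate (h1))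

Route `BiquadraticEisensteinDescent` (cell `pub/bsd-wall`, width seat `bsd-wall-cm-bed-w4` g33; `--supports` 21381, helper). File P5c
(`torsorClass_eq_zero_of_mem_sha_of_norm_cube_phi`) exported only the TORSOR consequence `[C_u] = 0` of its proof; the proof shows more,
namely that `u` itself is a cube in `F` — the statement «`Sel^φ` is trivial» needed for the RANK half of the descent (`E'(ℚ) ⊆ φ(E(ℚ))`,
file P7c-C). This file re-runs the (short) assembly of P5c with the stronger conclusion:

* ★★ `exists_eq_cube_of_mem_sha_of_norm_cube_phi` — `[F:ℚ] = 2`, `ω² = 6`, any `c ∈ Aut(F/ℚ)`, `p ≡ 8 (mod 9)` prime, `p = a² + 2b²`,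
  (h1) `∃ u₀ ∈ 𝓞_Fˣ, ∀ x, u₀ − x³ ∉ (p)`, Mordell datum `c″ = pω/3`: every `u ≠ 0` with `u·c(u)` a non-zero `c`-fixed cube and
  `[C_u] ∈ Ш(E_F/F)` is `w³`, `w ∈ F^×` (valuations ≡ 0 (P5a), `h(F) = 1` ⟹ `u = εz³`; `ε` a local cube at the inert `p` (P5b), hence a
  cube mod `(p)`, hence `η³` by (h1) and `U/U³ ≅ ℤ/3`).

HONEST FRAMING: Selmer-form of one box for ONE CM family; the point-level consequences, the rank, the crux (residual C⁺) and BSD are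
untouched. THEOREMS ONLY (no `def`, no named fact, no sorry). Supports stmt-BirchSwinnertonDyer-21381.
[cite: CohenPazuki2009, Proposition 2.2 and §4] [cite: SilvermanAEC2009, Thm. X.4.2 (a), Prop. X.4.9]
-/

noncomputable section

open scoped Classical WithZero

namespace Summit.BirchSwinnertonDyer.BirchSwinnertonDyer.Theorems.SylvesterTwistDescent

open Literature.NumberTheory.EllipticCurves Literature.NumberTheory.EllipticCurves.MordellDescent
open Literature.NumberTheory.NumberFields IsDedekindDomain IsDedekindDomain.HeightOneSpectrum NumberField
open Literature.NumberTheory.Automorphic Literature.NumberTheory.QuadraticFields Literature.NumberTheory.QuadraticFields.Quadratic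
open WithZero (log exp)

variable {F : Type} [Field F] [NumberField F] (hF2 : Module.finrank ℚ F = 2) {ω : F} (hω : ω ^ 2 = 6)
  (c : F ≃ₐ[ℚ] F) {p : ℕ} (hp : p.Prime) (hp9 : p % 9 = 8) {a b : ℤ} (hab : a ^ 2 + 2 * b ^ 2 = p)

include hF2 hω hp hp9 hab in
/-- ★★ **THE `φ`-BOX IN SELMER FORM: `u` is a cube.** For a quadratic number field `F ∋ ω`, `ω² = 6`, any `ℚ`-automorphism `c`, a prime
`p ≡ 8 (mod 9)` with `p = a² + 2b²`, the certificate (h1) «some unit `u₀ ∈ 𝓞_Fˣ` is not a cube modulo `(p)`», and the `μ₃`-kernel Mordell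
datum `E_F = mordellCurve(−3c″²)`, `c″ = pω/3`: every `u ≠ 0` with CUBE NORM (`u · c u = r³`, `c r = r`, `r ≠ 0`) whose class `[C_u]` lies in
`Ш(E_F/F)` is a cube `w³`, `w ∈ F^×`. [cite: CohenPazuki2009, Proposition 2.2 and §4] [cite: SilvermanAEC2009, Thm. X.4.2 (a), Prop. X.4.9] -/
theorem exists_eq_cube_of_mem_sha_of_norm_cube_phi
    (h1 : ∃ u₀ : (𝓞 F)ˣ, ∀ x : 𝓞 F, (u₀ : 𝓞 F) - x ^ 3 ∉ Ideal.span {(p : 𝓞 F)})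
    (hc' : (p * ω / 3 : F) ≠ 0) {D : F} (hD : D = -3 * (p * ω / 3) ^ 2) {u : F} (hu : u ≠ 0)
    (hnorm : ∃ r : F, c r = r ∧ r ≠ 0 ∧ u * c u = r ^ 3) (hsha : torsorClass hc' hD hu ∈ (mordellCurve D).sha) :
    ∃ w : F, w ≠ 0 ∧ u = w ^ 3 := by
  -- ### all valuations of `u` are divisible by `3` (P5a) and `h(F) = 1`: `u = ε z³`
  have hall : ∀ v : HeightOneSpectrum (𝓞 F), (3 : ℤ) ∣ log (v.valuation F u) :=
    three_dvd_log_valuation_phi hF2 hω c hc' hD hu hsha hnorm hp hp9 hab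
  have hd24 := discr_eq_twentyFour hF2 hω
  haveI : IsPrincipalIdealRing (𝓞 F) :=
    (NumberField.classNumber_eq_one_iff (K := F)).mp (classNumber_eq_one_of_discr_eq_twentyFour hF2 hd24)
  obtain ⟨ε, z, huz⟩ := exists_unit_mul_cube_of_forall_dvd_valuation (K := F) hu hall
  have hz0 : z ≠ 0 := by
    rintro rfl
    rw [zero_pow three_ne_zero, mul_zero] at huz
    exact hu huz
  -- ### the inert place `v₀ = (p)`
  have hsq6 : ¬ IsSquare (6 : ZMod p) := not_isSquare_six_zmod hp hp9 hab
  have hπ : Prime ((p : ℕ) : 𝓞 F) := prime_natCast_of_not_isSquare_six hF2 hω hp hsq6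
  obtain ⟨v₀, hv₀⟩ := exists_place_of_prime (K := F) hπ
  have hp5 : 5 ≤ p := by have := hp.two_le; omega
  have h2 : ((2 : ℕ) : 𝓞 F) ∉ v₀.asIdeal := by
    rw [hv₀]; exact natCast_not_mem_span_natCast hF2 (fun h => by have := Nat.le_of_dvd two_pos h; omega)
  have h3 : ((3 : ℕ) : 𝓞 F) ∉ v₀.asIdeal := by
    rw [hv₀]; exact natCast_not_mem_span_natCast hF2 (fun h => by have := Nat.le_of_dvd three_pos h; omega)
  have hvp : v₀.valuation F (p : F) = exp (-1 : ℤ) := by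
    rw [← coe_natCast_ringOfIntegers (K := F) p]; exact valuation_self_of_span hπ hv₀
  -- ### `u`, hence `ε`, is a cube in `F_{v₀}` (P5b)
  obtain ⟨z₁, hz₁0, hz₁⟩ := exists_eq_cube_adicCompletion_of_inert hω hc' hD hu hsha v₀ h2 h3 hvp (hall v₀)
  have hιz : algebraMap F (v₀.adicCompletion F) z ≠ 0 := (map_ne_zero _).mpr hz0
  have hεcube : algebraMap F (v₀.adicCompletion F) ((ε : 𝓞 F) : F) = (z₁ / algebraMap F (v₀.adicCompletion F) z) ^ 3 := by
    rw [div_pow, ← hz₁, huz, map_mul, map_pow, mul_div_cancel_right₀ _ (pow_ne_zero 3 hιz)]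
  -- ### so `ε` is a cube modulo `(p)`, hence the cube of a unit by (h1)
  obtain ⟨a₀, ha₀⟩ := exists_sub_pow_three_mem_of_eq_cube v₀ hεcube
  rw [hv₀] at ha₀
  obtain ⟨η, hη⟩ := exists_eq_pow_three_of_sub_cube_mem hF2 (by rw [hd24]; norm_num) _ h1 ⟨a₀, ha₀⟩
  -- ### `u = (η z)³`
  refine ⟨algebraMap (𝓞 F) F (η : 𝓞 F) * z, mul_ne_zero ?_ hz0, ?_⟩
  · exact RingOfIntegers.coe_ne_zero_iff.mpr (Units.ne_zero η)
  · rw [huz, hη, mul_pow, Units.val_pow_eq_pow_val, map_pow]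

end Summit.BirchSwinnertonDyer.BirchSwinnertonDyer.Theorems.SylvesterTwistDescent

end
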